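/-
Origin: expansion seat `planner-pub-hodgecm-pv09-g2-0`, handover 2026-08-18 (`HOME/pub-hodgecm-pv09-g2/lean/Pv09g2/RestrictedMeasureDatum.lean`, md5 501ca26f, 136 lines);
landed by the gen-6 packager in gate run 22 as `HodgeCM/PerL34/RestrictedMeasureDatum.lean` (import ^import Pv[0-9]+g[0-9]+\.→import HodgeCM.PerL34. ×1).
-/
import Summits.HodgeConjecture.HodgeCM.PerL34.AdelicFactorisation
import Summits.HodgeConjecture.HodgeCM.PerL34.RestrictedMeasure_3

/-!
# The SETUP datum of seam (I) is a THEOREM: `RestrictedProductMeasureDatum.ofLocal`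

Adapter between `HodgeCM.PerL34.RestrictedMeasure` (this seat: construction of the restricted
product measure on Mathlib's `Πʳ i, [G i, K i]`, Leahy Prop. 3.1.8 / Tate Thm 3.3.1 existence +
uniqueness as kernel theorems) and pv11's LANDED `HodgeCM.PerL34.AdelicFactorisation`
(`RestrictedProductMeasureDatum` = the same statement recorded as DATA + defining property, over
which Leahy Prop. 3.1.9 — the Euler factorisation `∫_A ⊗f_i = ∏' ∫ f_i` — and the N31 seam
`hEuler_of_pureTensor` / `rallis_field_of_pureTensor` are proved).

## What this file proves (KERNEL; no placeholders; axioms = the standard trio)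

* `RestrictedProductMeasureDatum.ofLocal K ν S₀ hKm hKne hK1 :
    RestrictedProductMeasureDatum ι G (Πʳ i, [G i, K i])` — every field, in particular
  `restrict_eq` (Leahy 3.1.8), is PROVED (`RestrictedMeasure.rpMeasure_restrict_rpBox`), with
  `μ := rpMeasure K ν S₀`, `C S := Π_{i∉S} K_i`, `ρ S := ⨂_{i∉S} ν_i|K_i`, `Aset S := A_S`,
  `e S :=` the coordinate gluing map;
* `nonempty`               : the datum type over `Πʳ i, [G i, K i]` is inhabited (NON-VACUITY of the
  SETUP hypothesis of seam (I));
* `sigmaFinite_ofLocal`, `ofLocal_unique` : σ-finiteness, and uniqueness of the measure among data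
  with the same cylinders and level product measures (Leahy 3.1.8, uniqueness clause);
* `Smoke` : a concrete toy inhabitant (`Πʳ n : ℕ, [ℝ ; [0,1]]`, Lebesgue measure at every place,
  `S₀ = ∅`), showing the side conditions are satisfiable as stated.

Consequently pv11's `integrable` / `hasProd_integral` / `integral_eq_tprod` / `hEuler_of_pureTensor`
/ `rallis_field_of_pureTensor` hold for `D := ofLocal K ν S₀ hKm hKne hK1` with NO setup hypothesis
left on the measure side; what remains labelled DATA for N31 is only the pure-tensor shape of the
integrand (`IsPureTensor`: ω = ⊗′ω_v, φ = ⊗φ_v, χ′ = ∏χ′_v — D5) and the local values / bounds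
(pv07, pv13), exactly as listed in `AdelicFactorisation`'s header.

PRINT anchors and labels: as in `Pv09g2/RestrictedMeasure.lean` (Leahy Prop. 3.1.8, PDF p. 89–90;
Tate, Cassels–Fröhlich §3.3) — quoted for orientation only, never used as hypotheses.  No
internally-minted statement is cited.

Split record: `STATUS.md ## Log` pv11 2026-08-18T04:08:26Z (offer), pv09-g2 04:15:29Z (accept).
Unit `pub-hodgecm-pv09-g2` (DAG-node prover #09, generation 2), 2026-08-18.  Fully kernel-checked.
-/

set_option autoImplicit false

noncomputable section

open MeasureTheory Set
open scoped RestrictedProduct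

namespace HodgeCM.PerL34.AdelicFactorisation.RestrictedProductMeasureDatum

open HodgeCM.PerL34.RestrictedMeasure

universe u v

variable {ι : Type u} {G : ι → Type v} [∀ i, MeasurableSpace (G i)] [Countable ι]

/-- **Construction (Leahy Prop. 3.1.8 / Tate Thm 3.3.1, existence, as a kernel theorem).**
Given countably many measurable spaces `G_i` with σ-finite measures `ν_i` and measurable nonempty
subsets `K_i ⊆ G_i` with `ν_i(K_i) = 1` for `i ∉ S₀`, the restricted product `Πʳ i, [G i, K i]`
(Mathlib's `RestrictedProduct`, filter `cofinite`) carries the measure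
`HodgeCM.PerL34.RestrictedMeasure.rpMeasure K ν S₀`, and together with the compact factors
`C S = Π_{i∉S} K_i`, their product probability measures `ρ_S`, the cylinders `A_S` and the gluing maps
`e_S` it is a `RestrictedProductMeasureDatum` in the sense of `HodgeCM.PerL34.AdelicFactorisation`:
every field, in particular `restrict_eq`, is PROVED. -/
def ofLocal (K : ∀ i, Set (G i)) (ν : ∀ i, Measure (G i)) [∀ i, SigmaFinite (ν i)] (S₀ : Finset ι)
    (hKm : ∀ i, MeasurableSet (K i)) (hKne : ∀ i, (K i).Nonempty)
    (hK1 : ∀ i, i ∉ S₀ → ν i (K i) = 1) :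
    RestrictedProductMeasureDatum ι G (Πʳ i, [G i, K i]) where
  ν := ν
  μ := rpMeasure K ν S₀
  S₀ := S₀
  C := fun S => ((i : {i // i ∉ S}) → K i)
  ρ := fun S => rho K ν hKne S
  prob := fun S => isProbabilityMeasure_rho K ν hKne hKm S
  Aset := fun S => rpBox K S
  measurableSet_Aset := fun S => measurableSet_rpBox K hKm S
  mono := fun _ _ h => rpBox_mono K h
  exhaust := fun a => exists_mem_rpBox K a
  e := fun S => glue K S
  emb := fun S => measurableEmbedding_glue K hKne hKm S
  range_e := fun S => range_glue K hKne S
  restrict_eq := fun _ hS => rpMeasure_restrict_rpBox K ν hKne hKm hK1 hS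

section projections

variable (K : ∀ i, Set (G i)) (ν : ∀ i, Measure (G i)) [∀ i, SigmaFinite (ν i)] (S₀ : Finset ι)
  (hKm : ∀ i, MeasurableSet (K i)) (hKne : ∀ i, (K i).Nonempty) (hK1 : ∀ i, i ∉ S₀ → ν i (K i) = 1)

/-- (Ported verbatim from the HodgeCMPerL package; no docstring in the source.) -/
@[simp] theorem ofLocal_ν : (ofLocal K ν S₀ hKm hKne hK1).ν = ν := rfl

/-- (Ported verbatim from the HodgeCMPerL package; no docstring in the source.) -/
@[simp] theorem ofLocal_μ : (ofLocal K ν S₀ hKm hKne hK1).μ = rpMeasure K ν S₀ := rfl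

/-- (Ported verbatim from the HodgeCMPerL package; no docstring in the source.) -/
@[simp] theorem ofLocal_S₀ : (ofLocal K ν S₀ hKm hKne hK1).S₀ = S₀ := rfl

/-- (Ported verbatim from the HodgeCMPerL package; no docstring in the source.) -/
@[simp] theorem ofLocal_Aset (S : Finset ι) : (ofLocal K ν S₀ hKm hKne hK1).Aset S = rpBox K S := rfl

/-- (Ported verbatim from the HodgeCMPerL package; no docstring in the source.) -/
@[simp] theorem ofLocal_e (S : Finset ι) : (ofLocal K ν S₀ hKm hKne hK1).e S = glue K S := rfl

/-- (Ported verbatim from the HodgeCMPerL package; no docstring in the source.) -/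
@[simp] theorem ofLocal_ρ (S : Finset ι) : (ofLocal K ν S₀ hKm hKne hK1).ρ S = rho K ν hKne S := rfl

include ν S₀ hKm hKne hK1 in
/-- Non-vacuity of the SETUP datum of seam (I): the type of restricted product measure data over
`Πʳ i, [G i, K i]` is inhabited. -/
theorem nonempty : Nonempty (RestrictedProductMeasureDatum ι G (Πʳ i, [G i, K i])) :=
  ⟨ofLocal K ν S₀ hKm hKne hK1⟩

/-- The measure of the constructed datum is σ-finite. -/
theorem sigmaFinite_ofLocal : SigmaFinite (ofLocal K ν S₀ hKm hKne hK1).μ :=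
  sigmaFinite_rpMeasure K ν hKm hK1

/-- The measure of the constructed datum is the unique one with the `restrict_eq` property for the
constructed cylinders, gluing maps and compact-factor measures. -/
theorem ofLocal_unique (D : RestrictedProductMeasureDatum ι G (Πʳ i, [G i, K i]))
    (hS₀ : D.S₀ = S₀) (hA : ∀ S, D.Aset S = rpBox K S)
    (he : ∀ S, S₀ ⊆ S → Measure.map (D.e S) ((Measure.pi fun i : ↥S => D.ν i.1).prod (D.ρ S)) =
      Measure.map (glue K S) ((Measure.pi fun i : {i // i ∈ S} => ν i).prod (rho K ν hKne S))) :
    D.μ = (ofLocal K ν S₀ hKm hKne hK1).μ :=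
  eq_rpMeasure K ν hKne hKm hK1 D.μ fun S hS => by
    rw [← hA, D.restrict_eq S (hS₀ ▸ hS), he S hS]

end projections

/-! ### Smoke test: a concrete inhabitant -/

namespace Smoke

/-- Toy instance: `Πʳ n : ℕ, [ℝ ; [0,1]]` with Lebesgue measure at every place and `S₀ = ∅`
(`vol [0,1] = 1`), as a `RestrictedProductMeasureDatum`. -/
example : RestrictedProductMeasureDatum ℕ (fun _ => ℝ) (Πʳ _n : ℕ, [ℝ, Icc (0 : ℝ) 1]) :=
  ofLocal (fun _ => Icc (0 : ℝ) 1) (fun _ => volume) ∅ (fun _ => measurableSet_Icc)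
    (fun _ => ⟨0, left_mem_Icc.2 zero_le_one⟩)
    (fun _ _ => by rw [Real.volume_Icc, sub_zero, ENNReal.ofReal_one])

end Smoke

end HodgeCM.PerL34.AdelicFactorisation.RestrictedProductMeasureDatum
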